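import Summits.CriticalPhenomena.PercolationContinuityZ3.Theses.PercClusterResistance
import Literature.Probability.Percolation.Percolation
import HarnessLib

/-!
# `PercClusterResistance.NashWilliamsCutsets` (stmt-CriticalPhenomena-5593) PROVED — Nash-Williams in flow form

RSW3 lane (lead, gen 29).  Item `stmt-CriticalPhenomena-5593` of route `CriticalPhenomena/PercClusterResistance` (support,
'provable now', deterministic): if `cut_k` (`k ∈ ℕ`) are pairwise disjoint finite edge sets each separating `0` from `∞` in
`ω` (the open cluster of `0` in `ω ∖ cut_k` is finite), then every finite-energy unit flow `f` from `0` on the open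
lattice edges satisfies `Σ_{k<n} |cut_k|⁻¹ ≤ Σ_{(x,y)} f(x,y)²` (Lyons–Peres (2.14)).

Proof: let `A_k` be the (finite) cluster of `0` in `ω ∖ cut_k`.  Summing the divergences over `A_k` gives flux `1`;
the internal ordered pairs cancel by antisymmetry, and an external pair `(x,y)`, `x ∈ A_k ∌ y`, carrying flow is an open
edge, hence in `cut_k`.  So `1 = Σ_{B_k} f ≤ |B_k|^{1/2} (Σ_{B_k} f²)^{1/2}` with `B_k ↪ cut_k` (Cauchy–Schwarz), and the
`B_k` are pairwise disjoint.  No definitions, no sorries.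

References: R. Lyons, Y. Peres, *Probability on Trees and Networks* (2016), (2.14) [LyonsPeres2016]; Nash-Williams (1959)
[Lyons1983].
-/

noncomputable section

namespace Summit.CriticalPhenomena.PercolationContinuityZ3.Theorems

namespace NashWilliams

open Literature.Probability.Percolation Literature.Probability.LatticeModels
open scoped Classical

/-- **Antisymmetric sums over a symmetric set of ordered pairs vanish.** [folklore] -/
theorem sum_filter_adj_eq_zero (A : Finset (Site 3)) (f : Site 3 → Site 3 → ℝ) (hanti : ∀ x y, f x y = -f y x) :
    ∑ x ∈ A, ∑ y ∈ ((zdGraph 3).neighborFinset x).filter (fun y => y ∈ A), f x y = 0 := by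
  have hg : ∀ x y, (if (zdGraph 3).Adj x y then f x y else 0) = -(if (zdGraph 3).Adj y x then f y x else 0) := by
    intro x y
    by_cases h : (zdGraph 3).Adj x y
    · rw [if_pos h, if_pos h.symm, hanti x y]
    · rw [if_neg h, if_neg (fun h' => h h'.symm), neg_zero]
  have hS : ∑ x ∈ A, ∑ y ∈ ((zdGraph 3).neighborFinset x).filter (fun y => y ∈ A), f x y =
      ∑ x ∈ A, ∑ y ∈ A, (if (zdGraph 3).Adj x y then f x y else 0) := by
    refine Finset.sum_congr rfl fun x _ => ?_
    rw [← Finset.sum_filter]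
    refine Finset.sum_congr ?_ fun _ _ => rfl
    ext y
    simp only [Finset.mem_filter, SimpleGraph.mem_neighborFinset]
    tauto
  rw [hS]
  have hcomm := Finset.sum_comm (s := A) (t := A) (f := fun x y => if (zdGraph 3).Adj x y then f x y else 0)
  have hneg : ∑ y ∈ A, ∑ x ∈ A, (if (zdGraph 3).Adj x y then f x y else 0) =
      -∑ y ∈ A, ∑ x ∈ A, (if (zdGraph 3).Adj y x then f y x else 0) := by
    rw [← Finset.sum_neg_distrib]
    refine Finset.sum_congr rfl fun y _ => ?_
    rw [← Finset.sum_neg_distrib]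
    exact Finset.sum_congr rfl fun x _ => hg x y
  linarith [hcomm, hneg]

/-- **Flux through one cutset**: with `A` the finite cluster of `0` in `ω ∖ cut`, the flow carried by the ordered pairs
`(x, y)`, `x ∈ A`, `y ∉ A`, `xy ∈ cut`, is `1`; there are at most `|cut|` of them; so `|cut|⁻¹ ≤ Σ f²` over them.
[cite: LyonsPeres2016, (2.14)] -/
theorem inv_card_le_sum_sq {ω : BondConfig (Site 3)} {cut : Finset (Sym2 (Site 3))}
    (hfin : (openCluster (ω \ ↑cut) (0 : Site 3)).Finite) {f : Site 3 → Site 3 → ℝ}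
    (hanti : ∀ x y, f x y = -f y x) (hsupp : ∀ x y, f x y ≠ 0 → (zdGraph 3).Adj x y ∧ s(x, y) ∈ ω)
    (hdiv : ∀ x, x ≠ 0 → ∑ y ∈ (zdGraph 3).neighborFinset x, f x y = 0)
    (hsrc : ∑ y ∈ (zdGraph 3).neighborFinset 0, f 0 y = 1) :
    ((cut.card : ℝ))⁻¹ ≤ ∑ q ∈ (hfin.toFinset.biUnion fun x => (((zdGraph 3).neighborFinset x).filter
        (fun y => y ∉ hfin.toFinset ∧ s(x, y) ∈ cut)).image (fun y => (x, y))), f q.1 q.2 ^ 2 := by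
  set A : Finset (Site 3) := hfin.toFinset with hA
  have hA0 : (0 : Site 3) ∈ A := by rw [hA, Set.Finite.mem_toFinset]; exact mem_openCluster_self _ _
  have hmemA : ∀ {x y : Site 3}, x ∈ A → s(x, y) ∈ ω → s(x, y) ∉ cut → x ≠ y → y ∈ A := by
    intro x y hx hω hc hne
    rw [hA, Set.Finite.mem_toFinset] at hx ⊢
    exact SimpleGraph.Reachable.trans hx (SimpleGraph.Adj.reachable ((openGraph_adj _ x y).2 ⟨⟨hω, hc⟩, hne⟩))
  -- the pairs carrying flux out of `A`
  set B : Finset (Site 3 × Site 3) := A.biUnion fun x => (((zdGraph 3).neighborFinset x).filter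
      (fun y => y ∉ A ∧ s(x, y) ∈ cut)).image (fun y => (x, y)) with hB
  have hmemB : ∀ q : Site 3 × Site 3, q ∈ B ↔ q.1 ∈ A ∧ (zdGraph 3).Adj q.1 q.2 ∧ q.2 ∉ A ∧ s(q.1, q.2) ∈ cut := by
    rintro ⟨x, y⟩
    simp only [hB, Finset.mem_biUnion, Finset.mem_image, Finset.mem_filter, SimpleGraph.mem_neighborFinset, Prod.mk.injEq]
    constructor
    · rintro ⟨x', hx', y', ⟨hadj, hy', hc⟩, rfl, rfl⟩; exact ⟨hx', hadj, hy', hc⟩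
    · rintro ⟨hx, hadj, hy, hc⟩; exact ⟨x, hx, y, ⟨hadj, hy, hc⟩, rfl, rfl⟩
  -- Step 1: total divergence over `A` is `1`
  have hflux : ∑ x ∈ A, ∑ y ∈ (zdGraph 3).neighborFinset x, f x y = 1 := by
    rw [← Finset.add_sum_erase A _ hA0, hsrc, Finset.sum_eq_zero fun x hx => hdiv x (Finset.ne_of_mem_erase hx), add_zero]
  -- Step 2: split into internal (vanishing) and external pairs
  have hsplit : ∀ x ∈ A, ∑ y ∈ (zdGraph 3).neighborFinset x, f x y =
      ∑ y ∈ ((zdGraph 3).neighborFinset x).filter (fun y => y ∈ A), f x y +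
        ∑ y ∈ ((zdGraph 3).neighborFinset x).filter (fun y => y ∉ A), f x y := fun x _ =>
    (Finset.sum_filter_add_sum_filter_not _ _ _).symm
  have hext : ∀ x ∈ A, ∑ y ∈ ((zdGraph 3).neighborFinset x).filter (fun y => y ∉ A), f x y =
      ∑ y ∈ ((zdGraph 3).neighborFinset x).filter (fun y => y ∉ A ∧ s(x, y) ∈ cut), f x y := by
    intro x hx
    symm
    refine Finset.sum_subset (fun y hy => ?_) (fun y hy hy' => ?_)
    · rw [Finset.mem_filter] at hy ⊢; exact ⟨hy.1, hy.2.1⟩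
    · rw [Finset.mem_filter] at hy hy'
      by_contra hne
      have h := hsupp x y hne
      have hyc : s(x, y) ∈ cut := by
        by_contra hc
        exact hy.2 (hmemA hx h.2 hc h.1.ne)
      exact hy' ⟨hy.1, hy.2, hyc⟩
  have hone : ∑ q ∈ B, f q.1 q.2 = 1 := by
    have h1 : ∑ q ∈ B, f q.1 q.2 = ∑ x ∈ A, ∑ y ∈ ((zdGraph 3).neighborFinset x).filter (fun y => y ∉ A ∧ s(x, y) ∈ cut), f x y := by
      rw [hB, Finset.sum_biUnion]
      · refine Finset.sum_congr rfl fun x _ => ?_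
        rw [Finset.sum_image fun y _ y' _ h => (Prod.mk.injEq _ _ _ _ ▸ h).2]
      · intro x _ x' _ hxx'
        simp only [Function.onFun]
        rw [Finset.disjoint_left]
        intro q hq hq'
        rw [Finset.mem_image] at hq hq'
        obtain ⟨y, -, rfl⟩ := hq
        obtain ⟨y', -, h⟩ := hq'
        exact hxx' ((Prod.mk.injEq _ _ _ _ ▸ h).1.symm)
    rw [h1]
    have h2 := sum_filter_adj_eq_zero A f hanti
    rw [← hflux, Finset.sum_congr rfl hsplit, Finset.sum_add_distrib, h2, zero_add]
    exact (Finset.sum_congr rfl hext).symm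
  -- Step 3: `|B| ≤ |cut|`
  have hcardB : B.card ≤ cut.card := by
    refine Finset.card_le_card_of_injOn (fun q => s(q.1, q.2)) (fun q hq => ((hmemB q).1 (Finset.mem_coe.1 hq)).2.2.2) ?_
    rintro ⟨x, y⟩ hq ⟨x', y'⟩ hq' h
    have h1 := (hmemB _).1 (Finset.mem_coe.1 hq)
    have h2 := (hmemB _).1 (Finset.mem_coe.1 hq')
    rcases Sym2.eq_iff.1 h with ⟨rfl, rfl⟩ | ⟨rfl, rfl⟩
    · rfl
    · exact absurd h2.1 h1.2.2.1
  -- Step 4: Cauchy–Schwarz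
  have hcs := Finset.sum_mul_sq_le_sq_mul_sq B (fun q => f q.1 q.2) (fun _ => (1 : ℝ))
  simp only [mul_one, one_pow, Finset.sum_const, nsmul_eq_mul, mul_one] at hcs
  rw [hone, one_pow] at hcs
  have hBpos : 0 < (B.card : ℝ) := by
    rcases Nat.eq_zero_or_pos B.card with h | h
    · rw [h] at hcs; simp at hcs; linarith
    · exact_mod_cast h
  have hS : ((B.card : ℝ))⁻¹ ≤ ∑ q ∈ B, f q.1 q.2 ^ 2 := by
    rw [inv_le_iff_one_le_mul₀ hBpos]
    linarith
  refine le_trans ?_ hS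
  exact inv_anti₀ hBpos (by exact_mod_cast hcardB)

/-- **`PercClusterResistance.NashWilliamsCutsets` (stmt-CriticalPhenomena-5593): the Nash-Williams inequality in flow form.**
`Σ_{k<n} |cut_k|⁻¹ ≤ Σ_{(x,y)} f(x,y)²`. [cite: LyonsPeres2016, (2.14)] -/
theorem nashWilliamsCutsets_proof : Summit.CriticalPhenomena.PercolationContinuityZ3.Theses.PercClusterResistance.NashWilliamsCutsets := by
  unfold Summit.CriticalPhenomena.PercolationContinuityZ3.Theses.PercClusterResistance.NashWilliamsCutsets
  rintro ω cut hfin hdisj f ⟨hanti, hsupp, hdiv, hsrc, hsum⟩ n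
  set B : ℕ → Finset (Site 3 × Site 3) := fun k => (hfin k).toFinset.biUnion fun x => (((zdGraph 3).neighborFinset x).filter
      (fun y => y ∉ (hfin k).toFinset ∧ s(x, y) ∈ cut k)).image (fun y => (x, y)) with hB
  have hmemB : ∀ k q, q ∈ B k → s(q.1, q.2) ∈ cut k := by
    intro k q hq
    simp only [hB, Finset.mem_biUnion, Finset.mem_image, Finset.mem_filter] at hq
    obtain ⟨x, -, y, ⟨-, -, hc⟩, rfl⟩ := hq
    exact hc
  have hk : ∀ k, ((cut k).card : ℝ)⁻¹ ≤ ∑ q ∈ B k, f q.1 q.2 ^ 2 := fun k =>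
    inv_card_le_sum_sq (hfin k) hanti hsupp hdiv hsrc
  have hdisjB : ∀ k ∈ Finset.range n, ∀ j ∈ Finset.range n, k ≠ j → Disjoint (B k) (B j) := by
    intro k _ j _ hkj
    rw [Finset.disjoint_left]
    intro q hq hq'
    exact Finset.disjoint_left.1 (hdisj hkj) (hmemB k q hq) (hmemB j q hq')
  calc ∑ k ∈ Finset.range n, ((cut k).card : ℝ)⁻¹ ≤ ∑ k ∈ Finset.range n, ∑ q ∈ B k, f q.1 q.2 ^ 2 :=
        Finset.sum_le_sum fun k _ => hk k
    _ = ∑ q ∈ (Finset.range n).biUnion B, f q.1 q.2 ^ 2 := (Finset.sum_biUnion hdisjB).symm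
    _ ≤ ∑' q : Site 3 × Site 3, f q.1 q.2 ^ 2 := hsum.sum_le_tsum _ fun q _ => sq_nonneg _

end NashWilliams

end Summit.CriticalPhenomena.PercolationContinuityZ3.Theorems

end
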